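import Mathlib
import Summits.MatrixMultiplication.MatrixMultiplication.Theorems.SnSubsetDichotomyHyperoctahedralThresholdGoodCollisionWalk

/-!
# The clean-pair atom closes `stub_poorRigidCore` (STUB-PLAN, glue)

Helper for crux `SnSubsetDichotomy.HyperoctahedralThreshold` (stmt-MatrixMultiplication-10883), line
`STUB-PLAN-stub_poorRigidCore` (`Cruxes/HyperoctahedralThreshold/STUB-PLAN-stub_poorRigidCore.md`).

`stub_poorRigidCoreOfCleanPair : CleanPairAtom → stub_poorRigidCore` (registered glue stub, bodies unfolded), where
`CleanPairAtom` (registered as `stub_cleanPairAtom`) is the weakest typed form of the line's atom: under the hypotheses of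
`stub_poorRigidCore`, either the conclusion holds outright, or at SOME root rung `v ≠ x` and SOME depth `a` with
`2a ≤ ⌊n^(1/4)⌋` there is ONE colliding pair of distinct reduced words of length `a` whose four trajectories avoid `R` and
whose rungs are pairwise equal/swapped/disjoint.  The proof is the landed extraction `stub_goodCollisionWalk` (p128095) plus
`k + 1 ≤ 2a ≤ ⌊n^(1/4)⌋ ≤ n^(1/4)`.  The Cauchy–Schwarz form `stub_rootAtom` implies `CleanPairAtom`
(`RootCensus.exists_collision_not_mem`, p128012), so this file is the sharper of the two interfaces.
-/

-- the tree's namespace `Summit.MatrixMultiplication.MatrixMultiplication.…` repeats a component by design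
set_option linter.dupNamespace false

namespace Summit.MatrixMultiplication.MatrixMultiplication.Theorems.HyperoctahedralThreshold

/-- **`stub_poorRigidCoreOfCleanPair`** (registered glue stub of stmt-MatrixMultiplication-10883):
`CleanPairAtom → stub_poorRigidCore`, both bodies unfolded.  One clean colliding pair at one root is enough. -/
theorem stub_poorRigidCoreOfCleanPair : (∃ n₀ : ℕ, ∀ n ≥ n₀, ∀ μ : Fin 3 → Equiv.Perm (Fin n), (∀ i, μ i * μ i = 1 ∧ ∀ v, μ i v ≠ v) → ∀ R : Finset (Fin n), (R.card : ℝ) ≤ (n : ℝ) ^ ((3 : ℝ) / 4) → (∀ z : List (Fin 3), z ≠ [] → List.IsChain (· ≠ ·) (z ++ z) → (z.length : ℝ) ≤ (n : ℝ) ^ ((1 : ℝ) / 4) → ∀ (m : ℕ) (x : Fin m → Fin n), Function.Injective x → (∀ i, z.foldl (fun v c => μ c v) (x i) = x i) → m ≤ (4 * z.length ^ 2) ^ (Nat.log 2 z.length + 1) * (R.card + 1)) → (∀ z : List (Fin 3), z ≠ [] → List.IsChain (· ≠ ·) (z ++ z) → (z.length : ℝ) ≤ (n : ℝ) ^ ((1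 : ℝ) / 4) → ∀ (m : ℕ) (x : Fin m → Fin n), Function.Injective x → (∀ i, z.foldl (fun v c => μ c v) (x i) = x i) → (∀ i j, ∀ s t : Fin z.length, ((z.take (s : ℕ)).foldl (fun v c => μ c v) (x i) = (z.take (t : ℕ)).foldl (fun v c => μ c v) (x i) ↔ (z.take (s : ℕ)).foldl (fun v c => μ c v) (x j) = (z.take (t : ℕ)).foldl (fun v c => μ c v) (x j))) → m ≤ 2 * (z.length * R.card) + z.length ^ 2 + 1) → (∃ (k : ℕ) (p q : Fin (k + 1) → Fin n) (col : Fin (k + 1) → Fin 3), (∀ i, p i ≠ q i) ∧ (∀ i, (μ (col i) (p i) = p (i + 1) ∧ μ (col i) (q i) = q (i + 1)) ∨ (μ (col i) (p i) = q (i + 1) ∧ μ (col i) (q i) = p (i + 1))) ∧ (∀ i, col i ≠ col (i + 1)) ∧ (∀ i j, (p i = p j ∧ q i = q j) ∨ (p i = q j ∧ q i = p j) ∨ (p i ≠ p j ∧ p i ≠ q j ∧ q i ≠ p j ∧ q i ≠ q j)) ∧ (∀ i, p i ∉ R ∧ q i ∉ R) ∧ ((k : ℝ) + 1) ≤ (n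 : ℝ) ^ ((1 : ℝ) / 4)) ∨ ∃ (a : ℕ) (v x : Fin n) (β β' : List (Fin 3)), 2 * a ≤ ⌊(n : ℝ) ^ ((1 : ℝ) / 4)⌋₊ ∧ v ≠ x ∧ β.length = a ∧ β'.length = a ∧ β ≠ β' ∧ List.IsChain (· ≠ ·) β ∧ List.IsChain (· ≠ ·) β' ∧ β.foldl (fun v b => μ b v) v = β'.foldl (fun v b => μ b v) v ∧ β.foldl (fun v b => μ b v) x = β'.foldl (fun v b => μ b v) x ∧ (∀ t ≤ a, (β.take t).foldl (fun v b => μ b v) v ∉ R ∧ (β.take t).foldl (fun v b => μ b v) x ∉ R ∧ (β'.take t).foldl (fun v b => μ b v) v ∉ R ∧ (β'.take t).foldl (fun v b => μ b v) x ∉ R) ∧ (∀ γ γ' : List (Fin 3), (γ = β ∨ γ = β') → (γ' = β ∨ γ' = β') → ∀ s ≤ a, ∀ t ≤ a, ((γ.take s).foldl (fun v b => μ b v) v = (γ'.take t).foldl (fun v b => μ b v) v ∧ (γ.take s).foldl (fun v b => μ b v) x = (γ'.take t).foldl (fun v b => μ b v) x) ∨ ((γ.take s).foldl (fun v b => μ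 b v) v = (γ'.take t).foldl (fun v b => μ b v) x ∧ (γ.take s).foldl (fun v b => μ b v) x = (γ'.take t).foldl (fun v b => μ b v) v) ∨ ((γ.take s).foldl (fun v b => μ b v) v ≠ (γ'.take t).foldl (fun v b => μ b v) v ∧ (γ.take s).foldl (fun v b => μ b v) v ≠ (γ'.take t).foldl (fun v b => μ b v) x ∧ (γ.take s).foldl (fun v b => μ b v) x ≠ (γ'.take t).foldl (fun v b => μ b v) v ∧ (γ.take s).foldl (fun v b => μ b v) x ≠ (γ'.take t).foldl (fun v b => μ b v) x))) → (∃ n₀ : ℕ, ∀ n ≥ n₀, ∀ μ : Fin 3 → Equiv.Perm (Fin n), (∀ i, μ i * μ i = 1 ∧ ∀ v, μ i v ≠ v) → ∀ R : Finset (Fin n), (R.card : ℝ) ≤ (n : ℝ) ^ ((3 : ℝ) / 4) → (∀ z : List (Fin 3), z ≠ [] → List.IsChain (· ≠ ·) (z ++ z) → (z.length : ℝ) ≤ (n : ℝ) ^ ((1 : ℝ) / 4) → ∀ (m : ℕ) (x : Fin m → Fin n), Function.Injective x → (∀ i, z.foldl (fun v c => μ c v) (x i) = x i) → m ≤ (4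 * z.length ^ 2) ^ (Nat.log 2 z.length + 1) * (R.card + 1)) → (∀ z : List (Fin 3), z ≠ [] → List.IsChain (· ≠ ·) (z ++ z) → (z.length : ℝ) ≤ (n : ℝ) ^ ((1 : ℝ) / 4) → ∀ (m : ℕ) (x : Fin m → Fin n), Function.Injective x → (∀ i, z.foldl (fun v c => μ c v) (x i) = x i) → (∀ i j, ∀ s t : Fin z.length, ((z.take (s : ℕ)).foldl (fun v c => μ c v) (x i) = (z.take (t : ℕ)).foldl (fun v c => μ c v) (x i) ↔ (z.take (s : ℕ)).foldl (fun v c => μ c v) (x j) = (z.take (t : ℕ)).foldl (fun v c => μ c v) (x j))) → m ≤ 2 * (z.length * R.card) + z.length ^ 2 + 1) → ∃ (k : ℕ) (p q : Fin (k + 1) → Fin n) (col : Fin (k + 1) → Fin 3), (∀ i, p i ≠ q i) ∧ (∀ i, (μ (col i) (p i) = p (i + 1) ∧ μ (col i) (q i) = q (i + 1)) ∨ (μ (col i) (p i) = q (i + 1) ∧ μ (col i) (q i) = p (i + 1))) ∧ (∀ i, col i ≠ col (i + 1)) ∧ (∀ i j, (p i = p j ∧ q i = q j) ∨ (p i = q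 j ∧ q i = p j) ∨ (p i ≠ p j ∧ p i ≠ q j ∧ q i ≠ p j ∧ q i ≠ q j)) ∧ (∀ i, p i ∉ R ∧ q i ∉ R) ∧ ((k : ℝ) + 1) ≤ (n : ℝ) ^ ((1 : ℝ) / 4)) := by
  intro h
  obtain ⟨n₀, hn₀⟩ := h
  refine ⟨n₀, fun n hn μ hμ R hR hpoor hrigid => ?_⟩
  rcases hn₀ n hn μ hμ R hR hpoor hrigid with hconcl |
      ⟨a, v, x, β, β', ha, hvx, hl, hl', hne, hc, hc', hcv, hcx, hRf, heod⟩
  · exact hconcl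
  · obtain ⟨k, p, q, col, h1, h2, h3, h4, h5, hk⟩ :=
      stub_goodCollisionWalk n a μ R v x β β' (fun b => (hμ b).1) hvx hl hl' hne hc hc' hcv hcx hRf heod
    refine ⟨k, p, q, col, h1, h2, h3, h4, h5, ?_⟩
    have hk' : k + 1 ≤ ⌊(n : ℝ) ^ ((1 : ℝ) / 4)⌋₊ := hk.trans ha
    have hfl := Nat.floor_le (Real.rpow_nonneg (Nat.cast_nonneg n) ((1 : ℝ) / 4))
    calc (k : ℝ) + 1 = ((k + 1 : ℕ) : ℝ) := by push_cast; ring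
      _ ≤ (⌊(n : ℝ) ^ ((1 : ℝ) / 4)⌋₊ : ℝ) := by exact_mod_cast hk'
      _ ≤ (n : ℝ) ^ ((1 : ℝ) / 4) := hfl

end Summit.MatrixMultiplication.MatrixMultiplication.Theorems.HyperoctahedralThreshold
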